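import Summits.ABC.StewartYu.ArchG3KStepDelta
import HarnessLib

/-!
# Cell abc-stewartyu, rung A1.L (crux r2 `ArchCoreRat`), WP-L.A parcel P-A5: the archimedean LEVEL INVARIANT in Δ-form and its k-steps

`Summits/ABC/StewartYu/ArchG3Levels.lean` — cell `abc-stewartyu` (HOME `run/shared/lean/pub/abc-stewartyu/`; TRANCHE PLAN v1.2 §4′ P-A5;
rulings R26(e) «the archimedean level invariant is stated on Δ-VALUES» and R27 (line `arch-g3-frame`: `stub_startArch` ⇒ level-0
invariant, `stub_levelsArch` = the level recursion, `stub_endArch`); seat lp-1 g8).  One definition (the `Prop`-valued structure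
`ArchLvInv`, the archimedean twin of `G3Setup.LvInvI` of `PadicG3LevelsI`) and theorems on `ArchG3Setup`; no named fact, no parameters.

`ArchLvInv S R B v pv lo L P w γ c e Xs T` — the state of Nesterenko's induction on `(s, ν)` (LNM 1819 Prop. 4.1 / (4.6)) for the generic
class family of `ArchG3Functions`: non-zero integer coefficients `pv` bounded by `P`; RELATIVE exponents `vᵢ` in the interval box
`loⱼ ≤ vᵢⱼ ≤ loⱼ + Lⱼ` containing `0` (so differences are bounded by `Lⱼ` and the half-step halves the box, as in `LvInvI`); the real SLAB
`|Lsum vᵢ − γ| ≤ w` (design B: the pigeonhole class of the functional `λ ↦ Σ λⱼ log αⱼ`, centre `γ` — `γ = 0` for exponents relative to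
a base point of the class; it controls the growth `e^{(w + V₀|Λ/b_{j₀}|)·R}` of the twisted functions on the far disc); the Δ-basis data
`c ≠ 0`, `e` (print: `c = 2ˢN`, `eₖ = 𝔛ₖ(wₛ)`); and the VANISHING IN Δ-FORM at the nodes:
`archφ R v B (pvΔ pv c e μ) (a, 0) x = 0` for `x ∈ 𝒳`, `a + |μ| < T` (print (4.6) `Φ_s(x, m) = 0`, `|m| < T`).

* `ArchLvInv.mono`, `.congr_R`, `.abs_le` (`|vᵢⱼ| ≤ Lⱼ`), `.abs_sub_le`, `.abs_E_sub_le` (`|E vᵢ − γ| ≤ w + V₀|Λ/b_{j₀}|`), `.abs_Lsum_le`;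
* **`ArchLvInv.kstep`** — nodes `|x| ≤ N` → `|x| ≤ N′ ≤ 3N + 2`, orders `T → T′` with `T′ + t ≤ T`, from `kstep_delta_symm` under the
  record's uniform sizes and the numerical inequality `hfinal` (one per new node `x₁` and multi-index `(a, μ)`, `a + |μ| < T′`);
* **`ArchLvInv.kstep_odd`** — the first k-step of a level: odd nodes `|x| ≤ 2m − 1` → all `|x| ≤ N′ ≤ 6m` (`kstep_delta_odd`).

WHAT THIS IS NOT: the START (Siegel in the Δ-basis, `stub_startArch`, seat p1), the half-step on the invariant (Kummer descent, P-A6), the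
END (P-A7) and the records (`ArchG3Par`, P-A8); no crux moves.

## References
* Yu. V. Nesterenko, LNM 1819 (2003) — §4 Prop. 4.1, (4.1)–(4.7) p. 79–81 (the induction on `(s, ν)` and the sets `𝒳_{s,ν}`), §4.2
  Lemma 4.3, (4.24)–(4.35) p. 84–90. [Nesterenko2003]
* K. Yu, Acta Math. 211 (2013) — §5 (the `p`-adic model, `G3Setup.LvInvI`). [Yu2013]
-/

noncomputable section

open Finset Polynomial
open Literature.NumberTheory.Transcendental
open Literature.NumberTheory.Transcendental.CW77.Setup (Tau tauNorm)
open scoped Nat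

namespace Summit.ABC.StewartYu

namespace ArchG3Setup

variable (S : ArchG3Setup) {ι : Type*}

/-- **The archimedean level invariant in Δ-form** (state of Nesterenko's induction for the generic class family; twin of
`G3Setup.LvInvI`). [cite: Nesterenko2003, §4 Prop. 4.1 and (4.6), p. 80–81; shape only] -/
structure ArchLvInv (R : ι → ℚ[X]) (B : Finset ι) (v : ι → Fin S.n → ℤ) (pv : ι → ℤ) (lo : Fin S.n → ℤ) (L : Fin S.n → ℕ)
    (P : ℤ) (w γ : ℝ) (c : ℤ) (e : Fin S.n → ℤ) (Xs : Set ℤ) (T : ℕ) : Prop where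
  /-- some coefficient is non-zero -/
  nonzero : ∃ i ∈ B, pv i ≠ 0
  /-- the coefficients are bounded -/
  bound : ∀ i ∈ B, |pv i| ≤ P
  /-- the interval box contains `0` -/
  lo_le : ∀ j, lo j ≤ 0 ∧ 0 ≤ lo j + L j
  /-- the exponents lie in the interval box -/
  box : ∀ i ∈ B, ∀ j, lo j ≤ v i j ∧ v i j ≤ lo j + L j
  /-- the real slab: the functional `Σ vⱼ log αⱼ` is within `w` of the centre `γ` on `B` -/
  slab : ∀ i ∈ B, |S.Lsum (v i) - γ| ≤ w
  /-- the Δ-basis scale is non-zero -/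
  c_ne : c ≠ 0
  /-- the vanishing in Δ-form at the nodes -/
  vanish : ∀ x ∈ Xs, ∀ (a : ℕ) (μ : Fin S.n → ℕ), a + ∑ k, μ k < T →
    S.archφ R v B (S.pvΔ v pv c e μ) ((a, 0) : Tau S.n) x = 0

namespace ArchLvInv

variable {S} {R : ι → ℚ[X]} {B : Finset ι} {v : ι → Fin S.n → ℤ} {pv : ι → ℤ} {lo : Fin S.n → ℤ} {L : Fin S.n → ℕ} {P : ℤ}
  {w γ : ℝ} {c : ℤ} {e : Fin S.n → ℤ} {Xs : Set ℤ} {T : ℕ}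

/-- Changing the node set and the order by an implication. [folklore] -/
theorem mono (h : S.ArchLvInv R B v pv lo L P w γ c e Xs T) {Xs' : Set ℤ} {T' : ℕ} (hX : Xs' ⊆ Xs) (hT : T' ≤ T) :
    S.ArchLvInv R B v pv lo L P w γ c e Xs' T' :=
  ⟨h.nonzero, h.bound, h.lo_le, h.box, h.slab, h.c_ne, fun x hx a μ haμ => h.vanish x (hX hx) a μ (lt_of_lt_of_le haμ hT)⟩

/-- Changing the `Y₀`-weights by polynomials with the same Hasse values at the integer nodes (e.g. `Δ(2^0·Y₀; ℓ, H) = Δ(Y₀; ℓ, H)` at the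
last level) does not change the invariant. [folklore] -/
theorem congr_R (h : S.ArchLvInv R B v pv lo L P w γ c e Xs T) {R' : ι → ℚ[X]}
    (hRR' : ∀ i ∈ B, ∀ (t : ℕ) (x : ℤ), (hasseDeriv t (R i)).eval (x : ℚ) = (hasseDeriv t (R' i)).eval (x : ℚ)) :
    S.ArchLvInv R' B v pv lo L P w γ c e Xs T := by
  refine ⟨h.nonzero, h.bound, h.lo_le, h.box, h.slab, h.c_ne, fun x hx a μ haμ => ?_⟩
  have h1 := h.vanish x hx a μ haμ
  unfold archφ at h1 ⊢
  rw [← h1]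
  exact sum_congr rfl fun i hi => by rw [hRR' i hi]

/-- The absolute box: `|vᵢⱼ| ≤ Lⱼ`. [folklore] -/
theorem abs_le (h : S.ArchLvInv R B v pv lo L P w γ c e Xs T) : ∀ i ∈ B, ∀ j, |v i j| ≤ (L j : ℤ) := by
  intro i hi j
  have h1 := h.box i hi j
  have h2 := h.lo_le j
  rw [_root_.abs_le]; constructor <;> omega

/-- Differences of exponents are bounded by `Lⱼ`. [folklore] -/
theorem abs_sub_le (h : S.ArchLvInv R B v pv lo L P w γ c e Xs T) : ∀ i ∈ B, ∀ i' ∈ B, ∀ j, |v i j - v i' j| ≤ (L j : ℤ) := by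
  intro i hi i' hi' j
  have h1 := h.box i hi j
  have h2 := h.box i' hi' j
  rw [_root_.abs_le]; constructor <;> omega

/-- `|Lsum vᵢ| ≤ |γ| + w` on `B`. [folklore] -/
theorem abs_Lsum_le (h : S.ArchLvInv R B v pv lo L P w γ c e Xs T) : ∀ i ∈ B, |S.Lsum (v i)| ≤ |γ| + w := by
  intro i hi
  have h1 := h.slab i hi
  have e1 : S.Lsum (v i) = (S.Lsum (v i) - γ) + γ := by ring
  rw [e1]
  exact (abs_add_le _ _).trans (by linarith)

/-- `|E vᵢ − γ| ≤ w + V₀·|Λ/b_{j₀}|` on `B` when `|vᵢ,j₀| ≤ V₀` (the exponent of the twisted function on the far disc).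
[cite: Nesterenko2003, §4.2 (4.16) and (4.27), p. 83–88] -/
theorem abs_E_sub_le (h : S.ArchLvInv R B v pv lo L P w γ c e Xs T) {V₀ : ℝ} (hV₀ : ∀ i ∈ B, |(v i S.j₀ : ℝ)| ≤ V₀) :
    ∀ i ∈ B, |S.E (v i) - γ| ≤ w + V₀ * |S.Λ / (S.b S.j₀ : ℝ)| := by
  intro i hi
  have h1 := h.slab i hi
  have h2 := S.abs_E_sub_Lsum (v i)
  have e1 : S.E (v i) - γ = (S.E (v i) - S.Lsum (v i)) + (S.Lsum (v i) - γ) := by ring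
  rw [e1]
  refine (abs_add_le _ _).trans ?_
  rw [h2]
  have h3 : |(v i S.j₀ : ℝ)| * |S.Λ / (S.b S.j₀ : ℝ)| ≤ V₀ * |S.Λ / (S.b S.j₀ : ℝ)| :=
    mul_le_mul_of_nonneg_right (hV₀ i hi) (abs_nonneg _)
  linarith

/-! ### The k-step on the invariant, symmetric nodes -/

/-- **The k-step on the archimedean invariant** (symmetric nodes `|x| ≤ N` → `|x| ≤ N′ ≤ 3N+2`, orders `T → T′` with `T′ + t ≤ T`,
`t ≥ 1`), under the record's uniform sizes — `|log αₖ| ≤ Aₖ`, `|𝔛ₖ(vᵢ)/b_{j₀}| ≤ Γₖ`, `|pvΔ μ i| ≤ PΔ` for `a + |μ| < T′`, `|vᵢ,j₀| ≤ V₀`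
with `V₀|Λ/b_{j₀}|(3N+2) ≤ 1`, Hasse weights `≤ Wd` (orders `< T′`) on the disc `‖z‖ ≤ (3E+1)(2N+1)+N` and Hasse values `≤ Wn`
(orders `< T`) at the integers `|x| ≤ 3N+2`, a ratio `E ≥ 1`, a jets scale `C ≥ 1`, clearing denominators `den₀ a x` of the Hasse values
— and the numerical inequality `hfinal` at every new node `x₁` and multi-index `(a, μ)`, `a + |μ| < T′`, written with the record's
MAJORANTS `Bc ≥ #B` (e.g. `#U` for the unknown set `U ⊇ B`) and `δ₀ ≥ |Λ/b_{j₀}|` (the negated lower bound) in place of the actual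
values (`V₀ = L_{j₀}`, `Lmax = |γ| + w`, `Emax = w + L_{j₀}δ₀`, box `Dbox = L`).  Twin of `G3Setup.LvInvI.kstep`.
[cite: Nesterenko2003, §4.2 Lemma 4.3, (4.24)–(4.35), p. 84–90] [cite: Yu2013, Lemma 5.2] -/
theorem kstep {N : ℕ} (h : S.ArchLvInv R B v pv lo L P w γ c e {x : ℤ | |x| ≤ (N : ℤ)} T) {N' T' t : ℕ} (ht : 1 ≤ t)
    (hT : T' + t ≤ T) (hN' : N' ≤ 3 * N + 2)
    {Bc : ℝ} (hBc : (B.card : ℝ) ≤ Bc)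
    {A : Fin S.n → ℝ} (hA : ∀ k, |S.lg k| ≤ A k)
    {Γ : Fin S.n → ℝ} (hΓ0 : ∀ k, 0 ≤ Γ k) (hΓ : ∀ i ∈ B, ∀ k, |(S.zγ (v i) k : ℝ)| ≤ Γ k)
    {PΔ : ℝ} (hPΔ0 : 0 ≤ PΔ)
    (hPΔ : ∀ (a : ℕ) (μ : Fin S.n → ℕ), a + ∑ k, μ k < T' → ∀ i ∈ B, |(S.pvΔ v pv c e μ i : ℝ)| ≤ PΔ)
    {E : ℝ} (hE : 1 ≤ E)
    {Wd : ℝ} (hWd : ∀ i ∈ B, ∀ a < T', ∀ z : ℂ, ‖z‖ ≤ (3 * E + 1) * (2 * N + 1) + N → ‖(hw R i a).eval z‖ ≤ Wd)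
    {Wn : ℝ} (hWn0 : 0 ≤ Wn)
    (hWn : ∀ i ∈ B, ∀ t₀ < T, ∀ x : ℤ, |x| ≤ 3 * (N : ℤ) + 2 → |(((hasseDeriv t₀ (R i)).eval (x : ℚ) : ℚ) : ℝ)| ≤ Wn)
    (hw0 : 0 ≤ w) {δ₀ : ℝ} (hΛ : |S.Λ / (S.b S.j₀ : ℝ)| ≤ δ₀)
    (hsmall : (L S.j₀ : ℝ) * δ₀ * (3 * N + 2) ≤ 1) {C : ℝ} (hC : 1 ≤ C)
    (den₀ : ℕ → ℤ → ℕ) (hden₀ : ∀ a x, 1 ≤ den₀ a x)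
    (hR : ∀ a < T', ∀ x : ℤ, |x| ≤ (N' : ℤ) → ∀ i ∈ B, ∃ z₀ : ℤ, (den₀ a x : ℚ) * (hasseDeriv a (R i)).eval (x : ℚ) = z₀)
    (hfinal : ∀ x₁ : ℤ, |x₁| ≤ (N' : ℤ) → ∀ (a : ℕ) (μ : Fin S.n → ℕ), a + ∑ k, μ k < T' →
      Real.exp (|γ| * N') *
        (2 * ((2 * N + 1 : ℕ) : ℝ) ^ (t + 1) * t * (20 * Real.exp 1) ^ ((2 * N + 1) * t) *
            ((2 * C) ^ t * Real.exp (|γ| * (N + 1)) *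
              ((2 : ℝ) ^ a * Real.exp ((∑ k, A k * Γ k) / C) *
                (Bc * PΔ * Wn * Real.exp ((|γ| + w) * N) * (2 * ((L S.j₀ : ℝ) * δ₀ * N))))) +
          Bc * PΔ * Wd * Real.exp ((w + (L S.j₀ : ℝ) * δ₀) * ((3 * E + 1) * (2 * N + 1) + N)) *
            (1 / E) ^ ((2 * N + 1) * t)) +
        Bc * PΔ * Wn * Real.exp ((|γ| + w) * N') * (2 * ((L S.j₀ : ℝ) * δ₀ * N')) <
      1 / ((den₀ a x₁ * MonomialDen.monDen S.α (fun j => L j * x₁.natAbs) : ℕ) : ℝ)) :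
    S.ArchLvInv R B v pv lo L P w γ c e {x : ℤ | |x| ≤ (N' : ℤ)} T' := by
  refine ⟨h.nonzero, h.bound, h.lo_le, h.box, h.slab, h.c_ne, fun x₁ hx₁ a μ haμ => ?_⟩
  have hL0 : 0 ≤ |γ| + w := by positivity
  have hδ : 0 ≤ |S.Λ / (S.b S.j₀ : ℝ)| := abs_nonneg _
  have hδ₀ : 0 ≤ δ₀ := hδ.trans hΛ
  have hV0 : (0 : ℝ) ≤ (L S.j₀ : ℝ) := Nat.cast_nonneg _
  have hV₀ : ∀ i ∈ B, |(v i S.j₀ : ℝ)| ≤ (L S.j₀ : ℝ) := fun i hi => by exact_mod_cast h.abs_le i hi S.j₀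
  have hN0 : (0 : ℝ) ≤ 3 * N + 2 := by positivity
  have hsmall' : (L S.j₀ : ℝ) * |S.Λ / (S.b S.j₀ : ℝ)| * (3 * N + 2) ≤ 1 :=
    le_trans (mul_le_mul_of_nonneg_right (mul_le_mul_of_nonneg_left hΛ hV0) hN0) hsmall
  have hEm : ∀ i ∈ B, |S.E (v i) - γ| ≤ w + (L S.j₀ : ℝ) * δ₀ := fun i hi =>
    (h.abs_E_sub_le hV₀ i hi).trans (by nlinarith [mul_le_mul_of_nonneg_left hΛ hV0])
  have hBc0 : (0 : ℝ) ≤ B.card := Nat.cast_nonneg _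
  refine S.kstep_delta_symm R v B pv h.c_ne e hN' ht (fun x hx a' μ' h' => h.vanish x hx a' μ' h') (by omega) x₁ hx₁ hA hΓ0 hΓ
    hPΔ0 (hPΔ a μ haμ) hE γ (fun i hi z hz => hWd i hi a (by omega) z hz) hWn0 hWn hL0 h.abs_Lsum_le hV0 hV₀ hsmall'
    hEm hC h.abs_le (hden₀ a x₁) (hR a (by omega) x₁ hx₁) (lt_of_le_of_lt ?_ (hfinal x₁ hx₁ a μ haμ))
  have hWd0 : 0 ≤ Wd := by
    obtain ⟨i₀, hi₀, _⟩ := h.nonzero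
    exact le_trans (norm_nonneg _) (hWd i₀ hi₀ a (by omega) 0 (by simp; positivity))
  have hBc0' : (0 : ℝ) ≤ Bc := hBc0.trans hBc
  gcongr

/-! ### The first k-step of a level, odd nodes -/

/-- **The first k-step of a level on the archimedean invariant** (odd nodes `|x| ≤ 2m − 1` → all `|x| ≤ N′ ≤ 6m`; twin of
`G3Setup.LvInvI.kstep_odd`), under the record's uniform sizes (disc `‖z‖ ≤ (12E+6)m`, Hasse values at `|x| ≤ 6m`, `V₀|Λ/b_{j₀}|·6m ≤ 1`)
and the numerical inequality with the odd-node constants. [cite: Nesterenko2003, §4.2 Lemma 4.3 with the nodes 𝒳_{s,0}, p. 84–90] -/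
theorem kstep_odd {m : ℕ} (h : S.ArchLvInv R B v pv lo L P w γ c e {x : ℤ | Odd x ∧ |x| ≤ 2 * (m : ℤ) - 1} T) {N' T' t : ℕ}
    (hm : 1 ≤ m) (ht : 1 ≤ t) (hT : T' + t ≤ T) (hN' : N' ≤ 6 * m)
    {Bc : ℝ} (hBc : (B.card : ℝ) ≤ Bc)
    {A : Fin S.n → ℝ} (hA : ∀ k, |S.lg k| ≤ A k)
    {Γ : Fin S.n → ℝ} (hΓ0 : ∀ k, 0 ≤ Γ k) (hΓ : ∀ i ∈ B, ∀ k, |(S.zγ (v i) k : ℝ)| ≤ Γ k)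
    {PΔ : ℝ} (hPΔ0 : 0 ≤ PΔ)
    (hPΔ : ∀ (a : ℕ) (μ : Fin S.n → ℕ), a + ∑ k, μ k < T' → ∀ i ∈ B, |(S.pvΔ v pv c e μ i : ℝ)| ≤ PΔ)
    {E : ℝ} (hE : 1 ≤ E)
    {Wd : ℝ} (hWd : ∀ i ∈ B, ∀ a < T', ∀ z : ℂ, ‖z‖ ≤ (12 * E + 6) * m → ‖(hw R i a).eval z‖ ≤ Wd)
    {Wn : ℝ} (hWn0 : 0 ≤ Wn)
    (hWn : ∀ i ∈ B, ∀ t₀ < T, ∀ x : ℤ, |x| ≤ 6 * (m : ℤ) → |(((hasseDeriv t₀ (R i)).eval (x : ℚ) : ℚ) : ℝ)| ≤ Wn)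
    (hw0 : 0 ≤ w) {δ₀ : ℝ} (hΛ : |S.Λ / (S.b S.j₀ : ℝ)| ≤ δ₀)
    (hsmall : (L S.j₀ : ℝ) * δ₀ * (6 * m) ≤ 1) {C : ℝ} (hC : 1 ≤ C)
    (den₀ : ℕ → ℤ → ℕ) (hden₀ : ∀ a x, 1 ≤ den₀ a x)
    (hR : ∀ a < T', ∀ x : ℤ, |x| ≤ (N' : ℤ) → ∀ i ∈ B, ∃ z₀ : ℤ, (den₀ a x : ℚ) * (hasseDeriv a (R i)).eval (x : ℚ) = z₀)
    (hfinal : ∀ x₁ : ℤ, |x₁| ≤ (N' : ℤ) → ∀ (a : ℕ) (μ : Fin S.n → ℕ), a + ∑ k, μ k < T' →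
      Real.exp (|γ| * N') *
        (2 * ((2 * m : ℕ) : ℝ) ^ (t + 1) * t * (20 * Real.exp 1) ^ ((2 * m) * t) *
            (2 ^ t * ((2 * C) ^ t * Real.exp (|γ| * (2 * m)) *
              ((2 : ℝ) ^ a * Real.exp ((∑ k, A k * Γ k) / C) *
                (Bc * PΔ * Wn * Real.exp ((|γ| + w) * ((2 * m - 1 : ℕ) : ℝ)) *
                  (2 * ((L S.j₀ : ℝ) * δ₀ * ((2 * m - 1 : ℕ) : ℝ))))))) +
          Bc * PΔ * Wd * Real.exp ((w + (L S.j₀ : ℝ) * δ₀) * ((12 * E + 6) * m)) * (1 / E) ^ ((2 * m) * t)) +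
        Bc * PΔ * Wn * Real.exp ((|γ| + w) * N') * (2 * ((L S.j₀ : ℝ) * δ₀ * N')) <
      1 / ((den₀ a x₁ * MonomialDen.monDen S.α (fun j => L j * x₁.natAbs) : ℕ) : ℝ)) :
    S.ArchLvInv R B v pv lo L P w γ c e {x : ℤ | |x| ≤ (N' : ℤ)} T' := by
  refine ⟨h.nonzero, h.bound, h.lo_le, h.box, h.slab, h.c_ne, fun x₁ hx₁ a μ haμ => ?_⟩
  have hL0 : 0 ≤ |γ| + w := by positivity
  have hδ : 0 ≤ |S.Λ / (S.b S.j₀ : ℝ)| := abs_nonneg _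
  have hδ₀ : 0 ≤ δ₀ := hδ.trans hΛ
  have hV0 : (0 : ℝ) ≤ (L S.j₀ : ℝ) := Nat.cast_nonneg _
  have hV₀ : ∀ i ∈ B, |(v i S.j₀ : ℝ)| ≤ (L S.j₀ : ℝ) := fun i hi => by exact_mod_cast h.abs_le i hi S.j₀
  have hm0 : (0 : ℝ) ≤ 6 * m := by positivity
  have hsmall' : (L S.j₀ : ℝ) * |S.Λ / (S.b S.j₀ : ℝ)| * (6 * m) ≤ 1 :=
    le_trans (mul_le_mul_of_nonneg_right (mul_le_mul_of_nonneg_left hΛ hV0) hm0) hsmall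
  have hEm : ∀ i ∈ B, |S.E (v i) - γ| ≤ w + (L S.j₀ : ℝ) * δ₀ := fun i hi =>
    (h.abs_E_sub_le hV₀ i hi).trans (by nlinarith [mul_le_mul_of_nonneg_left hΛ hV0])
  have hBc0 : (0 : ℝ) ≤ B.card := Nat.cast_nonneg _
  refine S.kstep_delta_odd R v B pv h.c_ne e hm hN' ht (fun x hxo hx a' μ' h' => h.vanish x ⟨hxo, hx⟩ a' μ' h') (by omega)
    x₁ hx₁ hA hΓ0 hΓ hPΔ0 (hPΔ a μ haμ) hE γ (fun i hi z hz => hWd i hi a (by omega) z hz) hWn0 hWn hL0 h.abs_Lsum_le hV0 hV₀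
    hsmall' hEm hC h.abs_le (hden₀ a x₁) (hR a (by omega) x₁ hx₁) (lt_of_le_of_lt ?_ (hfinal x₁ hx₁ a μ haμ))
  have hWd0 : 0 ≤ Wd := by
    obtain ⟨i₀, hi₀, _⟩ := h.nonzero
    exact le_trans (norm_nonneg _) (hWd i₀ hi₀ a (by omega) 0 (by simp; positivity))
  have hBc0' : (0 : ℝ) ≤ Bc := hBc0.trans hBc
  gcongr

end ArchLvInv

end ArchG3Setup

end Summit.ABC.StewartYu

end
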